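import Summits.CriticalPhenomena.PercolationContinuityZ3.Theorems.PercNearOneGluingNoHeavyLowerTailAntitheticShiftCodes
import HarnessLib

/-!
# `NoHeavyLowerTail` (stmt-CriticalPhenomena-4575) — antithetic cluster pairs: the COMPUTABLE DATA of SEPARABLE ("flow ⊗ flow")
# certificates for shifted-BIC positivity (monomials, run checker; prim-hp-2 gen 67, HOME/MEMO-gen67.md §3)

Support file (`--supports stmt-CriticalPhenomena-4575`, hull-port prover `prim-hp-2`, gen 67).  COMPUTABLE DEFINITIONS ONLY (their soundness is
…AntitheticSepDecide); no named facts, no sorries; standard axioms.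

THE FORMAT (MEMO-gen67 §3).  A shifted-BIC statement `0 ≤ Σ_a (F⁺(X_a) − F⁻(Y_a))(G⁺(X_a) − G⁻(Y_a))` (all monotone `F⁻ ≤ F⁺`, `G⁻ ≤ G⁺`) is
`F̂ᵀ W Ĝ ≥ 0` for all monotone `F̂, Ĝ` on the lattice of codes `u < 2^n` (bit `i < n − 1` ↔ coordinate vertex `i`, bit `n − 1` ↔ the point
at infinity marking the `F⁺`-side), where `W = Σ_a (e_{x_a} − e_{y_a})(e_{x_a} − e_{y_a})ᵀ` over the histogram of code pairs `(x_a, y_a)`.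
A SEPARABLE CERTIFICATE is a list of `(a, b, a', b', c)` with `a ⊆ b`, `a' ⊆ b'` (bitwise) and `c ∈ ℕ` such that
`N · W = Σ c · (e_b − e_a)(e_{b'} − e_{a'})ᵀ` for some `N ≥ 1`; then `N · F̂ᵀWĜ = Σ c (F̂ b − F̂ a)(Ĝ b' − Ĝ a') ≥ 0`.  Existence = membership of
`W` in the tensor square `𝒞* ⊗ 𝒞*` of the dual of the monotone cone — an LP; `K_{2,4}`, the 4-fan, `W₅`, `K_{3,3}`, … all have one
(kit j292196), although `K_{2,4}` has no cube certificate of dimension ≤ 3 even in the matched sense (HOME/MEMO-gen65 §5).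
* `Antithetic.SepCert.key n u v = u * 2^n + v`; `monosW`, `monosC` — the monomials `(key, coefficient)` of `N · W` and of `−(certificate)`;
* `runsZero` — after sorting by key, every run of equal keys has coefficient sum `0`; `check n N h cert` — side conditions (codes `< 2^n`,
  `a &&& b = a`, `a' &&& b' = a'`, `N ≥ 1`) and `runsZero` of the merged sorted monomial list.  Cost `O(K log K)`, `K = 4(|h| + |cert|)`.
[cite: VandenbergHaggstromKahn2005, §1 p. 6 ("Harris' inequality")]
-/

namespace Summit.CriticalPhenomena.PercolationContinuityZ3.Theorems

namespace Antithetic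

namespace SepCert

/-- Key of a pair of codes. [this work] -/
def key (n u v : ℕ) : ℕ := u * 2 ^ n + v

/-- Monomials of `N · W` for the histogram `h` of `(x, y, multiplicity)`. [this work] -/
def monosW (n N : ℕ) (h : List (ℕ × ℕ × ℕ)) : List (ℕ × ℤ) :=
  h.flatMap fun e => [(key n e.1 e.1, (N : ℤ) * e.2.2), (key n e.2.1 e.2.1, (N : ℤ) * e.2.2),
    (key n e.1 e.2.1, -((N : ℤ) * e.2.2)), (key n e.2.1 e.1, -((N : ℤ) * e.2.2))]

/-- Monomials of MINUS the certificate `Σ c (e_b − e_a)(e_{b'} − e_{a'})ᵀ`, entries `(a, b, a', b', c)`. [this work] -/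
def monosC (n : ℕ) (cert : List (ℕ × ℕ × ℕ × ℕ × ℕ)) : List (ℕ × ℤ) :=
  cert.flatMap fun e => [(key n e.2.1 e.2.2.2.1, -(e.2.2.2.2 : ℤ)), (key n e.1 e.2.2.1, -(e.2.2.2.2 : ℤ)),
    (key n e.2.1 e.2.2.1, (e.2.2.2.2 : ℤ)), (key n e.1 e.2.2.2.1, (e.2.2.2.2 : ℤ))]

/-- Run checker: the list splits into consecutive runs of equal keys, each with coefficient sum `0`. [this work] -/
def runsZero : List (ℕ × ℤ) → Bool
  | [] => true
  | (k, c) :: t =>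
    (c + ((t.takeWhile fun p => p.1 == k).map Prod.snd).sum == 0) && runsZero (t.dropWhile fun p => p.1 == k)
  termination_by l => l.length
  decreasing_by
    simp only [List.length_cons]
    exact Nat.lt_succ_of_le (List.dropWhile_suffix _).length_le

/-- **The checker** of a separable certificate `cert` with scale `N` for the histogram `h` on the lattice of codes `< 2^n`. [this work] -/
def check (n N : ℕ) (h : List (ℕ × ℕ × ℕ)) (cert : List (ℕ × ℕ × ℕ × ℕ × ℕ)) : Bool :=
  decide (0 < N) &&
  h.all (fun e => decide (e.1 < 2 ^ n) && decide (e.2.1 < 2 ^ n)) &&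
  cert.all (fun e => decide (e.2.1 < 2 ^ n) && decide (e.2.2.2.1 < 2 ^ n) && (e.1 &&& e.2.1 == e.1) && (e.2.2.1 &&& e.2.2.2.1 == e.2.2.1)) &&
  runsZero ((monosW n N h ++ monosC n cert).mergeSort fun p q => p.1 ≤ q.1)

end SepCert

end Antithetic

end Summit.CriticalPhenomena.PercolationContinuityZ3.Theorems
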